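import Summits.QuantumFields.BalabanUV.T4Continuum.Support.AveragingDeficitNearIdentity
import Summits.QuantumFields.BalabanUV.T4Continuum.Support.AveragingDeficitCounting

/-!
# AveragingDeficitDerivCore (T⁴ programme, node NE3, row NE3-R2) — THE PER-PLAQUETTE CORE ESTIMATE OF THE
# DERIVATIVE WALL β, TYPED, and the index-set / locality / double-counting bookkeeping that assembles it
# (file 1/2 of the assembly; file 2/2 `AveragingDeficitDerivAssembly` proves `β ⇐ CoarseCore`)

HONEST FRAMING (cell `pub-balaban`, T4-DAG PAGE 1; unit `b2b-balaban-t4-ne3r2-p1` = owner of BINDER-OWNERS row NE3-R2).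
The cell's T4 target is the finite-torus continuum limit of the unit-scale averaged loop expectations — NOT infinite volume,
NO mass gap, NOT Clay, NOT summit progress.  NE3 on the energy route has exactly one open input, β =
`T4AveragingDeficitWall.DeficitDerivWall d N L C a₀ R` (GAPS G-ne3p2-1).  THIS PAIR OF FILES DOES NOT PROVE β.  It
REDUCES β, in the kernel, to ONE LOCAL STATEMENT ABOUT ONE COARSE PLAQUETTE, `CoarseCore d N L c₁ c₂ a₀ R_b` (typed here,
asserted nowhere, carrying no citation — it is this unit's own proof obligation, to be discharged in the axial gauge of
B7 p. 24 by the layers (W) Wilson-weight pairing [done: `AveragingDeficitNearIdentity.abs_nReTr_mul_sub_mul_mlog_le`],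
(DL) derivative-level linearisation of the average (42), (M) main bilinear term by covariant telescoping):
for every `U(N)`-valued small-field `V` (`|V(∂p) − 1| ≤ a ≤ a₀`), every `𝔲(N)`-valued direction `ψ`, every coarse
plaquette `P = (y, π)` (fine corner `Ly`, plane `π = (μ,ν)`) and every derivative `t` of `s ↦ 1 − Re tr \overline{V e^{sψ}}(∂P)`
at `s = 0`,
  `|t + L^{2−d}·Σ_{k∈stencil(P)} Re tr((d_Vψ)(p_k)·F(p_k))|`
  `  ≤ c₁ · (Σ_k ‖(d_Vψ)(p_k)‖) · (Σ_{x∈box R_b(Ly),κ} ‖(∇_V F)(x,κ;π)‖) + c₂ · a² · (Σ_{x∈box R_b(Ly),κ} ‖ψ(x,κ)‖ + Σ_k ‖(d_Vψ)(p_k)‖)`,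
`p_k = (Ly + r + ie_μ + je_ν, π)` the `L^{d+2}` stencil plaquettes, `F = flux = log V(∂p)`, `∇_V` = `covGrad`.  WHY THIS
SHAPE (this unit's analysis, record `t4/T4-EST-NE3-R2.md` §2): `t = −Re tr(Ω_P V̄(∂P))` with `Ω_P` skew, so
`t = −Re tr(Ω_P(V̄(∂P) − 1)) = −Re tr(Ω_P Θ_P) + O(a²‖Ω_P‖)` by the tree's flux linearisation
(`T4AveragingDeficitNonAbelian.fluxLinearisation`: `log V̄₀(∂P) = Θ_P + O(θ²)`, `Θ_P = L^{−d}Σ_k F(p_k)` in the axial gauge);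
`Ω_P = L^{−d}Σ_k (d_Vψ)(p_k) + O(a·Σ‖ψ‖)` is (DL); and `Re tr(Σ_k G_k · Σ_{k'} F_{k'}) = L^{d+2}Σ_k Re tr(G_kF_k) + Σ_{k,k'}
Re tr(G_k(F_{k'}^{transported} − F_k))` with `‖F_{k'}^{transported} − F_k‖ ≤ Σ_{path} ‖∇_VF‖ + O(a²)` (covariant telescoping,
`AveragingDeficitNearIdentity.norm_Ad_hol_sub_le_sum_covGrad`) is (M): `L^{−2d}·L^{d+2} = L^{2−d}`.  The STENCIL-DIAGONAL
`L^{2−d}Σ_k Re tr(G_kF_k)` is kept on the LEFT because, summed over all coarse plaquettes with the deficit's weight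
`L^{d−4}`, it reproduces the fine-side main term EXACTLY (`L^{d−4}·L^{2−d}·L² = 1`: every fine plaquette lies in `L²`
stencils, `AveragingDeficitCounting.sum_stencil_sum_eq`) — the derivative-level form of «the quadratic parts cancel
exactly» of the value wall.
WHAT IS HERE (all [folklore] bookkeeping, 0 sorry).  §1 the stencil plaquettes and the local functionals `stencilCurlL1`,
`stencilPair`, `boxGradL1`; `CoarseCore` (A DEFINITION, the typed per-plaquette wall).  §2 support / locality: `eq_zero_of_supportedOn`,
`deriv_term_eq_zero_of_far` (the coarse term of `P` is constant in `s` when `ψ = 0` within `ℓ¹`-distance `(2d+3)L` of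
`Ly`, by `AveragingDeficitLocality.chol_vary_eq_of_l1`), `curl_eq_zero_of_far`.  §3 the index sets `ySet`/`pSet`/`fSet` of a
support `S` and their covering properties.  §4 the three dominations of the summed local right-hand sides by the wall's
functionals on `nbhd R (bondSites S)` (`sum_dirL1_box_le`, `sum_stencilCurlL1_le`, `sum_stencilCurl_mul_boxGrad_le`).
CITATION HEADER: nothing printed is a hypothesis; the manuscripts under audit are not cited for any disputed step; context:
T. Bałaban, Commun. Math. Phys. **98** (1985) 17–51 [Balaban1985Averaging] ((42) p. 23 the average, (44) p. 24 the
`L`-plaquette variable), **102** (1985) 277–309 [Balaban1985Variational] ((5) p. 278 the Wilson weight), **95** (1984)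
17–40 [Balaban1984PropagatorsI] ((1.6) p. 18 blocks).  PLACEMENT: `Summits/QuantumFields/BalabanUV/` (human rule
2026-08-19).  Record: HOME `t4/T4-EST-NE3-R2.md`; predecessors `t4/T4-EST-NE3-P2.md` v1.33, Appendix β v0.19.
-/

set_option autoImplicit false

open scoped BigOperators Matrix Matrix.Norms.L2Operator Topology
open NormedSpace Finset Filter

namespace Summit.QuantumFields.BalabanUV.T4Continuum.AveragingDeficitDerivCore

open Literature.MathematicalPhysics.QuantumFieldTheory.Balaban1983to89
open B7Prop1Explicit B7Prop2Explicit MatrixLog UnitaryModel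
open T4AveragingDeficitWall hiding Site Plane Plaq Bond
open T4AveragingDeficitWallBoundary (stencilIdx stencilOff card_stencilIdx)
open AveragingDeficitTransport AveragingDeficitLocality AveragingDeficitNearIdentity AveragingDeficitCounting

noncomputable section

variable {d : ℕ} {n : Type*} [Fintype n] [DecidableEq n]

local notation "𝕄" => Matrix n n ℂ
local notation "Site" => B7Prop1Explicit.Site
local notation "Plane" => T4AveragingDeficitWall.Plane
local notation "Plaq" => T4AveragingDeficitWall.Plaq
local notation "Bond" => T4AveragingDeficitWall.Bond

/-! ## §1 Stencil plaquettes, the local functionals, and the typed per-plaquette wall `CoarseCore` -/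

/-- The `k`-th stencil plaquette of the coarse plaquette `(y, π)`: fine corner `Ly + r + ie_μ + je_ν`, plane `π`.
[cite: Balaban1985Averaging, (42) p.23, (44) p.24] -/
def stencilPlaq (L : ℕ) (y : Site d) (π : Plane d) (k : (Fin d → Fin L) × (ℕ × ℕ)) : Plaq d :=
  ((L : ℤ) • y + stencilOff L π.1.1 π.1.2 k, π)

/-- `Σ_{k ∈ stencil(P)} ‖(d_Vψ)(p_k)‖`. [folklore] -/
def stencilCurlL1 (L : ℕ) (V : Site d → Fin d → 𝕄ˣ) (ψ : Site d → Fin d → 𝕄) (y : Site d) (π : Plane d) : ℝ :=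
  ∑ k ∈ stencilIdx d L, ‖curl V ψ (stencilPlaq L y π k)‖

/-- The stencil-diagonal pairing `Σ_{k ∈ stencil(P)} Re tr((d_Vψ)(p_k) · F(p_k))`. [folklore] -/
def stencilPair (L : ℕ) (V : Site d → Fin d → 𝕄ˣ) (ψ : Site d → Fin d → 𝕄) (y : Site d) (π : Plane d) : ℝ :=
  ∑ k ∈ stencilIdx d L, nReTr (curl V ψ (stencilPlaq L y π k) * flux V (stencilPlaq L y π k))

/-- `Σ_{x ∈ box R (Ly)} Σ_κ ‖(∇_V F)(x, κ; π)‖` — the plane-`π` covariant flux gradient, `ℓ¹` over the box. [folklore] -/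
def boxGradL1 (L : ℕ) (V : Site d → Fin d → 𝕄ˣ) (R : ℕ) (y : Site d) (π : Plane d) : ℝ :=
  ∑ x ∈ box R ((L : ℤ) • y), ∑ κ : Fin d, ‖covGrad V (flux V) x κ π‖

/-- `stencilCurlL1 ≥ 0`. [folklore] -/
theorem stencilCurlL1_nonneg (L : ℕ) (V : Site d → Fin d → 𝕄ˣ) (ψ : Site d → Fin d → 𝕄) (y : Site d) (π : Plane d) :
    0 ≤ stencilCurlL1 L V ψ y π := Finset.sum_nonneg fun _ _ => norm_nonneg _

/-- `boxGradL1 ≥ 0`. [folklore] -/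
theorem boxGradL1_nonneg (L : ℕ) (V : Site d → Fin d → 𝕄ˣ) (R : ℕ) (y : Site d) (π : Plane d) :
    0 ≤ boxGradL1 L V R y π := Finset.sum_nonneg fun _ _ => Finset.sum_nonneg fun _ _ => norm_nonneg _

/-- `dirL1 ≥ 0`. [folklore] -/
theorem dirL1_nonneg (ψ : Site d → Fin d → 𝕄) (N : Finset (Site d)) : 0 ≤ dirL1 ψ N :=
  Finset.sum_nonneg fun _ _ => Finset.sum_nonneg fun _ _ => norm_nonneg _

variable (d n) in
/-- **THE PER-PLAQUETTE CORE ESTIMATE OF β, TYPED** (this unit's proof obligation; asserted nowhere, no citation): for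
every unitary small-field `V` (`SmallField V a`, `0 ≤ a ≤ a₀`), every skew direction `ψ`, every coarse plaquette `(y, π)`
and every derivative `t` at `0` of `s ↦ wt(\overline{V e^{sψ}}(∂P))`,
`|t + L^{2−d}·stencilPair| ≤ c₁·stencilCurlL1·boxGradL1(R_b) + c₂·a²·(dirL1(box R_b (Ly)) + stencilCurlL1)`. [folklore] -/
def CoarseCore (L : ℕ) (c₁ c₂ a₀ : ℝ) (Rb : ℕ) : Prop :=
  ∀ (V : Site d → Fin d → 𝕄ˣ), IsUnitaryCfg V →
  ∀ (a : ℝ), 0 ≤ a → a ≤ a₀ → SmallField V a →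
  ∀ (ψ : Site d → Fin d → 𝕄), IsSkewDir ψ →
  ∀ (y : Site d) (π : Plane d) (t : ℝ),
    HasDerivAt (fun s : ℝ => wt (chol L (vary V ψ s) (y, π))) t 0 →
    |t + (L : ℝ) ^ ((2 : ℤ) - d) * stencilPair L V ψ y π|
      ≤ c₁ * stencilCurlL1 L V ψ y π * boxGradL1 L V Rb y π
        + c₂ * a ^ 2 * (dirL1 ψ (box Rb ((L : ℤ) • y)) + stencilCurlL1 L V ψ y π)

/-! ## §2 Support and locality -/

omit [Fintype n] [DecidableEq n] in
/-- A direction supported in `S` vanishes on every bond whose initial point is not in `bondSites S`. [folklore] -/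
theorem eq_zero_of_supportedOn {ψ : Site d → Fin d → 𝕄} {S : Finset (Bond d)} (hS : SupportedOn ψ S) {x : Site d}
    (hx : x ∉ bondSites S) (κ : Fin d) : ψ x κ = 0 := by
  refine hS x κ fun h => hx ?_
  exact Finset.mem_image.mpr ⟨(x, κ), h, rfl⟩

omit [DecidableEq n] in
/-- If `ψ` (supported in `S`) does not vanish within `ℓ¹`-distance `R` of `z`, then `z` lies in the `ℓ^∞`
`R`-neighbourhood of `bondSites S`; contrapositive form. [folklore] -/
theorem vanish_of_not_mem_nbhd {ψ : Site d → Fin d → 𝕄} {S : Finset (Bond d)} (hS : SupportedOn ψ S) {R : ℕ}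
    {z : Site d} (hz : z ∉ nbhd R (bondSites S)) :
    ∀ (x' : Site d) (κ' : Fin d), l1 (x' - z) ≤ R → ψ x' κ' = 0 := by
  intro x' κ' hx'
  by_contra h
  apply hz
  have hxS : x' ∈ bondSites S := Finset.mem_image.mpr ⟨(x', κ'), by_contra fun h' => h (hS x' κ' h'), rfl⟩
  refine mem_nbhd_iff.mpr ⟨x', hxS, mem_box_iff.mpr fun κ => ?_⟩
  rw [abs_sub_comm]
  have h1 : ((x' - z) κ).natAbs ≤ l1 (x' - z) :=
    Finset.single_le_sum (f := fun κ => ((x' - z) κ).natAbs) (fun _ _ => Nat.zero_le _) (Finset.mem_univ κ)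
  have h2 : |(x' - z) κ| = (((x' - z) κ).natAbs : ℤ) := (Int.natCast_natAbs _).symm
  rw [show x' κ - z κ = (x' - z) κ from rfl, h2]
  exact_mod_cast h1.trans hx'

/-- **The coarse term of a far plaquette does not move**: if `Ly ∉ nbhd ((2d+3)L) (bondSites S)` then
`wt(\overline{V e^{sψ}}(∂P)) = wt(V̄(∂P))` for all `s`, so its derivative at `0` is `0`. [cite: Balaban1985Averaging, (42) p.23, (44) p.24] -/
theorem deriv_term_eq_zero_of_far (L : ℕ) (V : Site d → Fin d → 𝕄ˣ) {ψ : Site d → Fin d → 𝕄} {S : Finset (Bond d)}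
    (hS : SupportedOn ψ S) {y : Site d} (π : Plane d) (hy : (L : ℤ) • y ∉ nbhd ((2 * d + 3) * L) (bondSites S))
    {t : ℝ} (ht : HasDerivAt (fun s : ℝ => wt (chol L (vary V ψ s) (y, π))) t 0) : t = 0 := by
  have hconst : HasDerivAt (fun s : ℝ => wt (chol L (vary V ψ s) (y, π))) 0 0 := by
    refine (hasDerivAt_const (0 : ℝ) (wt (chol L V (y, π)))).congr_of_eventuallyEq ?_
    exact Filter.Eventually.of_forall fun s => by
      show wt (chol L (vary V ψ s) (y, π)) = wt (chol L V (y, π))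
      rw [chol_vary_eq_of_l1 L V s (y, π) (vanish_of_not_mem_nbhd hS hy)]
  exact ht.unique hconst

/-- **The dressed curl of a far plaquette vanishes**: `x ∉ nbhd 4 (bondSites S)` ⇒ `(d_Vψ)(x; π) = 0`. [folklore] -/
theorem curl_eq_zero_of_far (V : Site d → Fin d → 𝕄ˣ) {ψ : Site d → Fin d → 𝕄} {S : Finset (Bond d)}
    (hS : SupportedOn ψ S) {x : Site d} (π : Plane d) (hx : x ∉ nbhd 4 (bondSites S)) : curl V ψ (x, π) = 0 :=
  curl_eq_zero_of_l1 V (x, π) (vanish_of_not_mem_nbhd hS hx)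

/-! ## §3 The index sets of a support -/

/-- The `ℓ^∞` radius collecting every coarse site whose plaquette terms can see the support. [folklore] -/
def yRad (d L : ℕ) : ℕ := (2 * d + 3) * L + 2 * L + 4

/-- The coarse sites `y = ⌊x/L⌋`, `x` within `yRad` of the support. [folklore] -/
def ySet (L : ℕ) (S : Finset (Bond d)) : Finset (Site d) := (nbhd (yRad d L) (bondSites S)).image (blockIdx L)

/-- A coarse site whose base `Ly` is within `yRad` of the support lies in `ySet`. [folklore] -/
theorem mem_ySet_of_mem_nbhd (L : ℕ) (hL : 1 ≤ L) {S : Finset (Bond d)} {y : Site d} {R : ℕ} (hR : R ≤ yRad d L)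
    (hy : (L : ℤ) • y ∈ nbhd R (bondSites S)) : y ∈ ySet L S :=
  Finset.mem_image.mpr ⟨(L : ℤ) • y, nbhd_mono hR _ hy, blockIdx_smul L hL y⟩

/-- Coarse sites NOT in `ySet` are far: `Ly ∉ nbhd ((2d+3)L) (bondSites S)`. [folklore] -/
theorem far_of_not_mem_ySet (L : ℕ) (hL : 1 ≤ L) {S : Finset (Bond d)} {y : Site d} (hy : y ∉ ySet L S) :
    (L : ℤ) • y ∉ nbhd ((2 * d + 3) * L) (bondSites S) := fun h =>
  hy (mem_ySet_of_mem_nbhd L hL (by unfold yRad; omega) h)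

/-- A site within `yRad` of the support is a block site of `ySet`. [folklore] -/
theorem mem_blockSites_ySet (L : ℕ) (hL : 1 ≤ L) {S : Finset (Bond d)} {x : Site d}
    (hx : x ∈ nbhd (yRad d L) (bondSites S)) : x ∈ blockSites L (ySet L S) :=
  mem_blockSites_of L hL (Finset.mem_image.mpr ⟨x, hx, rfl⟩)

/-- Bases of `ySet` are within `yRad + (L − 1)` of the support. [folklore] -/
theorem base_mem_nbhd_of_mem_ySet (L : ℕ) (hL : 1 ≤ L) {S : Finset (Bond d)} {y : Site d} (hy : y ∈ ySet L S) :
    (L : ℤ) • y ∈ nbhd (yRad d L + (L - 1)) (bondSites S) := by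
  obtain ⟨x, hx, rfl⟩ := Finset.mem_image.mp hy
  exact mem_nbhd_of_mem_box hx (mem_box_comm.mp (mem_box_blockBase L hL x))

/-- Block sites of `ySet` are within `yRad + 2(L − 1)` of the support. [folklore] -/
theorem mem_nbhd_of_mem_blockSites_ySet (L : ℕ) (hL : 1 ≤ L) {S : Finset (Bond d)} {x : Site d}
    (hx : x ∈ blockSites L (ySet L S)) : x ∈ nbhd (yRad d L + (L - 1) + (L - 1)) (bondSites S) :=
  mem_nbhd_of_mem_box (base_mem_nbhd_of_mem_ySet L hL (blockIdx_mem_of_mem_blockSites L hL hx))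
    (mem_box_blockBase L hL x)

/-- In-plane shifts by `i, j < L` stay within `ℓ^∞`-distance `2(L − 1)`. [folklore] -/
theorem shift_mem_box (L : ℕ) (x : Site d) (μ ν : Fin d) {i j : ℕ} (hi : i < L) (hj : j < L) (σ : ℤ)
    (hσ : σ = 1 ∨ σ = -1) : x + σ • ((i : ℤ) • e μ + (j : ℤ) • e ν) ∈ box (2 * (L - 1)) x := by
  rw [mem_box_iff]
  intro κ
  have hL1 : ((2 * (L - 1) : ℕ) : ℤ) = 2 * (L : ℤ) - 2 := by omega
  have hi' : (i : ℤ) ≤ (L : ℤ) - 1 := by omega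
  have hj' : (j : ℤ) ≤ (L : ℤ) - 1 := by omega
  have key : |σ * ((i : ℤ) * (if κ = μ then 1 else 0) + (j : ℤ) * (if κ = ν then 1 else 0))| ≤ 2 * (L : ℤ) - 2 := by
    rw [abs_mul]
    have hσ1 : |σ| = 1 := by rcases hσ with rfl | rfl <;> simp
    rw [hσ1, one_mul]
    split_ifs <;> simp only [mul_one, mul_zero, add_zero, zero_add] <;> rw [abs_le] <;> constructor <;> linarith
  simpa only [Pi.add_apply, Pi.smul_apply, smul_eq_mul, B7Prop1Explicit.e_apply, add_sub_cancel_left, hL1,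
    mul_add] using key

/-! ## §4 The summed local right-hand sides against the wall's functionals -/

/-- The assembly radius: every box / stencil / fine site used lies in `nbhd (wallRad) (bondSites S)`. [folklore] -/
def wallRad (d L Rb : ℕ) : ℕ := yRad d L + 6 * L + Rb

/-- `box Rb (Ly) ⊆ nbhd wallRad` for `y ∈ ySet`. [folklore] -/
theorem box_subset_wall (L : ℕ) (hL : 1 ≤ L) (Rb : ℕ) {S : Finset (Bond d)} {y : Site d} (hy : y ∈ ySet L S) :
    box Rb ((L : ℤ) • y) ⊆ nbhd (wallRad d L Rb) (bondSites S) :=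
  (box_subset_nbhd (base_mem_nbhd_of_mem_ySet L hL hy)).trans (nbhd_mono (by unfold wallRad; omega) _)

/-- Shifted block sites of `ySet` lie in `nbhd wallRad`. [folklore] -/
theorem shift_blockSites_mem_wall (L : ℕ) (hL : 1 ≤ L) (Rb : ℕ) {S : Finset (Bond d)} (μ ν : Fin d) {x : Site d}
    (hx : x ∈ blockSites L (ySet L S)) {i j : ℕ} (hi : i ∈ Finset.range L) (hj : j ∈ Finset.range L) :
    x + (i : ℤ) • e μ + (j : ℤ) • e ν ∈ nbhd (wallRad d L Rb) (bondSites S) := by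
  have h1 := mem_nbhd_of_mem_blockSites_ySet L hL hx
  have h2 := shift_mem_box L x μ ν (Finset.mem_range.mp hi) (Finset.mem_range.mp hj) 1 (Or.inl rfl)
  rw [one_smul, ← add_assoc] at h2
  exact nbhd_mono (by unfold wallRad; omega) _ (mem_nbhd_of_mem_box h1 h2)

/-- `nbhd 4 ⊆ nbhd wallRad`. [folklore] -/
theorem nbhd4_subset_wall (L Rb : ℕ) (S : Finset (Bond d)) :
    nbhd 4 (bondSites S) ⊆ nbhd (wallRad d L Rb) (bondSites S) := nbhd_mono (by unfold wallRad yRad; omega) _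

/-- **(S1)** `Σ_{y∈ySet} Σ_π ‖ψ‖_{ℓ¹(box Rb (Ly))} ≤ #Plane·(2Rb+1)^d · ‖ψ‖_{ℓ¹(nbhd wallRad)}`. [folklore] -/
theorem sum_dirL1_box_le (L : ℕ) (hL : 1 ≤ L) (Rb : ℕ) (ψ : Site d → Fin d → 𝕄) (S : Finset (Bond d)) :
    ∑ y ∈ ySet L S, ∑ _π : Plane d, dirL1 ψ (box Rb ((L : ℤ) • y))
      ≤ (Fintype.card (Plane d)) * (2 * Rb + 1) ^ d * dirL1 ψ (nbhd (wallRad d L Rb) (bondSites S)) := by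
  simp only [Finset.sum_const, Finset.card_univ, nsmul_eq_mul, ← Finset.mul_sum]
  rw [mul_assoc]
  refine mul_le_mul_of_nonneg_left ?_ (Nat.cast_nonneg _)
  unfold T4AveragingDeficitWall.dirL1
  exact sum_box_sum_le L hL Rb (ySet L S) _ (fun x => ∑ κ : Fin d, ‖ψ x κ‖)
    (fun _ => Finset.sum_nonneg fun _ _ => norm_nonneg _) fun y hy => box_subset_wall L hL Rb hy

/-- **(S2)** `Σ_{y∈ySet} Σ_π stencilCurlL1 ≤ L² · ‖d_Vψ‖_{ℓ¹(nbhd wallRad)}`. [folklore] -/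
theorem sum_stencilCurlL1_le (L : ℕ) (hL : 1 ≤ L) (Rb : ℕ) (V : Site d → Fin d → 𝕄ˣ) (ψ : Site d → Fin d → 𝕄)
    (S : Finset (Bond d)) :
    ∑ y ∈ ySet L S, ∑ π : Plane d, stencilCurlL1 L V ψ y π
      ≤ (L : ℝ) ^ 2 * curlL1 V ψ (nbhd (wallRad d L Rb) (bondSites S)) := by
  calc ∑ y ∈ ySet L S, ∑ π : Plane d, stencilCurlL1 L V ψ y π
      = ∑ π : Plane d, ∑ y ∈ ySet L S, stencilCurlL1 L V ψ y π := Finset.sum_comm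
    _ ≤ ∑ π : Plane d, (L : ℝ) ^ 2 * ∑ x ∈ nbhd (wallRad d L Rb) (bondSites S), ‖curl V ψ (x, π)‖ :=
        Finset.sum_le_sum fun π _ =>
          sum_stencil_sum_le L hL (ySet L S) _ (fun x => ‖curl V ψ (x, π)‖) (fun _ => norm_nonneg _) π.1.1 π.1.2
            fun x hx i hi j hj => shift_blockSites_mem_wall L hL Rb π.1.1 π.1.2 hx hi hj
    _ = (L : ℝ) ^ 2 * curlL1 V ψ (nbhd (wallRad d L Rb) (bondSites S)) := by
        unfold T4AveragingDeficitWall.curlL1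
        rw [← Finset.mul_sum, Finset.sum_comm]

/-- `Σ_{y∈ySet} Σ_π Σ_k ‖(d_Vψ)(p_k)‖² ≤ L² · ‖d_Vψ‖²_{ℓ²(nbhd wallRad)}`. [folklore] -/
theorem sum_stencilCurlSq_le (L : ℕ) (hL : 1 ≤ L) (Rb : ℕ) (V : Site d → Fin d → 𝕄ˣ) (ψ : Site d → Fin d → 𝕄)
    (S : Finset (Bond d)) :
    ∑ y ∈ ySet L S, ∑ π : Plane d, ∑ k ∈ stencilIdx d L, ‖curl V ψ (stencilPlaq L y π k)‖ ^ 2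
      ≤ (L : ℝ) ^ 2 * curlSq V ψ (nbhd (wallRad d L Rb) (bondSites S)) := by
  calc ∑ y ∈ ySet L S, ∑ π : Plane d, ∑ k ∈ stencilIdx d L, ‖curl V ψ (stencilPlaq L y π k)‖ ^ 2
      = ∑ π : Plane d, ∑ y ∈ ySet L S, ∑ k ∈ stencilIdx d L, ‖curl V ψ (stencilPlaq L y π k)‖ ^ 2 :=
        Finset.sum_comm
    _ ≤ ∑ π : Plane d, (L : ℝ) ^ 2 * ∑ x ∈ nbhd (wallRad d L Rb) (bondSites S), ‖curl V ψ (x, π)‖ ^ 2 :=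
        Finset.sum_le_sum fun π _ =>
          sum_stencil_sum_le L hL (ySet L S) _ (fun x => ‖curl V ψ (x, π)‖ ^ 2) (fun _ => sq_nonneg _) π.1.1 π.1.2
            fun x hx i hi j hj => shift_blockSites_mem_wall L hL Rb π.1.1 π.1.2 hx hi hj
    _ = (L : ℝ) ^ 2 * curlSq V ψ (nbhd (wallRad d L Rb) (bondSites S)) := by
        unfold T4AveragingDeficitWall.curlSq
        rw [← Finset.mul_sum, Finset.sum_comm]

/-- `Σ_{y∈ySet} Σ_π Σ_{x∈box Rb(Ly)} Σ_κ ‖∇_VF(x,κ;π)‖² ≤ (2Rb+1)^d · ‖∇_VF‖²_{ℓ²(nbhd wallRad)}`. [folklore] -/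
theorem sum_boxGradSq_le (L : ℕ) (hL : 1 ≤ L) (Rb : ℕ) (V : Site d → Fin d → 𝕄ˣ) (S : Finset (Bond d)) :
    ∑ y ∈ ySet L S, ∑ π : Plane d, ∑ x ∈ box Rb ((L : ℤ) • y), ∑ κ : Fin d, ‖covGrad V (flux V) x κ π‖ ^ 2
      ≤ (2 * Rb + 1) ^ d * gradFluxSq V (nbhd (wallRad d L Rb) (bondSites S)) := by
  calc ∑ y ∈ ySet L S, ∑ π : Plane d, ∑ x ∈ box Rb ((L : ℤ) • y), ∑ κ : Fin d, ‖covGrad V (flux V) x κ π‖ ^ 2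
      = ∑ π : Plane d, ∑ y ∈ ySet L S, ∑ x ∈ box Rb ((L : ℤ) • y), ∑ κ : Fin d, ‖covGrad V (flux V) x κ π‖ ^ 2 :=
        Finset.sum_comm
    _ ≤ ∑ π : Plane d, (2 * Rb + 1) ^ d *
          ∑ x ∈ nbhd (wallRad d L Rb) (bondSites S), ∑ κ : Fin d, ‖covGrad V (flux V) x κ π‖ ^ 2 :=
        Finset.sum_le_sum fun π _ =>
          sum_box_sum_le L hL Rb (ySet L S) _ (fun x => ∑ κ : Fin d, ‖covGrad V (flux V) x κ π‖ ^ 2)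
            (fun _ => Finset.sum_nonneg fun _ _ => sq_nonneg _) fun y hy => box_subset_wall L hL Rb hy
    _ = (2 * Rb + 1) ^ d * gradFluxSq V (nbhd (wallRad d L Rb) (bondSites S)) := by
        unfold T4AveragingDeficitWall.gradFluxSq
        rw [← Finset.mul_sum, Finset.sum_comm]
        congr 1
        exact Finset.sum_congr rfl fun x _ => Finset.sum_comm

/-- **(S3)** the Cauchy–Schwarz assembly of the main term:
`Σ_{y∈ySet} Σ_π stencilCurlL1·boxGradL1 ≤ √(L^{d+4}·‖d_Vψ‖²_{ℓ²}) · √((2Rb+1)^{2d}·d·‖∇_VF‖²_{ℓ²})` on `nbhd wallRad`.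
[folklore] -/
theorem sum_stencilCurl_mul_boxGrad_le (L : ℕ) (hL : 1 ≤ L) (Rb : ℕ) (V : Site d → Fin d → 𝕄ˣ) (ψ : Site d → Fin d → 𝕄)
    (S : Finset (Bond d)) :
    ∑ y ∈ ySet L S, ∑ π : Plane d, stencilCurlL1 L V ψ y π * boxGradL1 L V Rb y π
      ≤ Real.sqrt ((L : ℝ) ^ (d + 4) * curlSq V ψ (nbhd (wallRad d L Rb) (bondSites S)))
        * Real.sqrt (((2 * Rb + 1 : ℕ) : ℝ) ^ (2 * d) * d * gradFluxSq V (nbhd (wallRad d L Rb) (bondSites S))) := by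
  set N := nbhd (wallRad d L Rb) (bondSites S) with hN
  rw [← Finset.sum_product']
  refine (Real.sum_mul_le_sqrt_mul_sqrt _ _ _).trans ?_
  refine mul_le_mul (Real.sqrt_le_sqrt ?_) (Real.sqrt_le_sqrt ?_) (Real.sqrt_nonneg _) (Real.sqrt_nonneg _)
  · -- `Σ SG² ≤ L^{d+2} Σ_q Σ_k ‖G_k‖² ≤ L^{d+4} curlSq`
    set U : Site d × Plane d → ℝ := fun q => ∑ k ∈ stencilIdx d L, ‖curl V ψ (stencilPlaq L q.1 q.2 k)‖ ^ 2 with hU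
    have h1 : ∀ q : Site d × Plane d, stencilCurlL1 L V ψ q.1 q.2 ^ 2 ≤ (L : ℝ) ^ (d + 2) * U q := by
      intro q
      refine (sq_sum_le_card_mul_sum_sq (s := stencilIdx d L)
        (f := fun k => ‖curl V ψ (stencilPlaq L q.1 q.2 k)‖)).trans (le_of_eq ?_)
      rw [card_stencilIdx]; push_cast; rfl
    have hUsum : ∑ q ∈ ySet L S ×ˢ (Finset.univ : Finset (Plane d)), U q ≤ (L : ℝ) ^ 2 * curlSq V ψ N := by
      rw [Finset.sum_product]
      exact sum_stencilCurlSq_le L hL Rb V ψ S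
    calc ∑ q ∈ ySet L S ×ˢ (Finset.univ : Finset (Plane d)), stencilCurlL1 L V ψ q.1 q.2 ^ 2
        ≤ ∑ q ∈ ySet L S ×ˢ (Finset.univ : Finset (Plane d)), (L : ℝ) ^ (d + 2) * U q :=
          Finset.sum_le_sum fun q _ => h1 q
      _ = (L : ℝ) ^ (d + 2) * ∑ q ∈ ySet L S ×ˢ (Finset.univ : Finset (Plane d)), U q := by rw [Finset.mul_sum]
      _ ≤ (L : ℝ) ^ (d + 2) * ((L : ℝ) ^ 2 * curlSq V ψ N) := mul_le_mul_of_nonneg_left hUsum (by positivity)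
      _ = (L : ℝ) ^ (d + 4) * curlSq V ψ N := by ring
  · -- `Σ SF² ≤ (2Rb+1)^d · d · Σ_q T q ≤ (2Rb+1)^{2d} d gradFluxSq`
    set T : Site d × Plane d → ℝ := fun q =>
      ∑ x ∈ box Rb ((L : ℤ) • q.1), ∑ κ : Fin d, ‖covGrad V (flux V) x κ q.2‖ ^ 2 with hT
    have h1 : ∀ q : Site d × Plane d, boxGradL1 L V Rb q.1 q.2 ^ 2 ≤ ((2 * Rb + 1 : ℕ) : ℝ) ^ d * ((d : ℝ) * T q) := by
      intro q
      refine (sq_sum_le_card_mul_sum_sq (s := box Rb ((L : ℤ) • q.1))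
        (f := fun x => ∑ κ : Fin d, ‖covGrad V (flux V) x κ q.2‖)).trans ?_
      rw [card_box_eq]
      push_cast
      refine mul_le_mul_of_nonneg_left ?_ (by positivity)
      rw [hT, Finset.mul_sum]
      refine Finset.sum_le_sum fun x _ => ?_
      refine (sq_sum_le_card_mul_sum_sq (s := (Finset.univ : Finset (Fin d)))
        (f := fun κ => ‖covGrad V (flux V) x κ q.2‖)).trans (le_of_eq ?_)
      rw [Finset.card_univ, Fintype.card_fin]
    have hTsum : ∑ q ∈ ySet L S ×ˢ (Finset.univ : Finset (Plane d)), T q ≤ (2 * Rb + 1) ^ d * gradFluxSq V N := by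
      rw [Finset.sum_product]
      exact sum_boxGradSq_le L hL Rb V S
    have hT0 : 0 ≤ ∑ q ∈ ySet L S ×ˢ (Finset.univ : Finset (Plane d)), T q :=
      Finset.sum_nonneg fun _ _ => Finset.sum_nonneg fun _ _ => Finset.sum_nonneg fun _ _ => sq_nonneg _
    calc ∑ q ∈ ySet L S ×ˢ (Finset.univ : Finset (Plane d)), boxGradL1 L V Rb q.1 q.2 ^ 2
        ≤ ∑ q ∈ ySet L S ×ˢ (Finset.univ : Finset (Plane d)), ((2 * Rb + 1 : ℕ) : ℝ) ^ d * ((d : ℝ) * T q) :=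
          Finset.sum_le_sum fun q _ => h1 q
      _ = ((2 * Rb + 1 : ℕ) : ℝ) ^ d * ((d : ℝ) * ∑ q ∈ ySet L S ×ˢ (Finset.univ : Finset (Plane d)), T q) := by
          rw [Finset.mul_sum, Finset.mul_sum]
      _ ≤ ((2 * Rb + 1 : ℕ) : ℝ) ^ d * ((d : ℝ) * ((2 * Rb + 1) ^ d * gradFluxSq V N)) := by
          refine mul_le_mul_of_nonneg_left (mul_le_mul_of_nonneg_left hTsum (Nat.cast_nonneg d)) (by positivity)
      _ = ((2 * Rb + 1 : ℕ) : ℝ) ^ (2 * d) * d * gradFluxSq V N := by push_cast; ring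

end

end Summit.QuantumFields.BalabanUV.T4Continuum.AveragingDeficitDerivCore
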